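import Literature.Analysis.FluidPDE.ParabolicWeakMaxNoncylindrical
import Summits.NavierStokesRegularity.FluidComputer.SwirlRateBarrierTools
import Literature.Analysis.FluidPDE.SwirlMaximumPrincipleForced
import Literature.Analysis.FluidPDE.SelfSimilarLiouville
import HarnessLib

/-!
# The swirl never blows up faster than the meridional flow: a barrier for `Γ = r u_θ` at an axis
# point on shrinking balls `|x − c| ≤ ℓ(t)`, for an ARBITRARY non-increasing length scale `ℓ`

Cell `ns-blowup`, seat `ns-blowup-ecbridge-2` (g13). Proof file (NO definitions, no named facts,
no `sorry`). `SwirlTypeIBarrier.lean` works in the Type-I variable `|x − c|/√(T − t)`; THIS FILE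
removes the Type-I scale: for ANY differentiable, positive, NON-INCREASING length scale
`ℓ(t) ≤ ℓ₀` on `[t₀, T']` and any axis point `c`, under the ONE-SIDED one-component bound

  `⟪x − c, u(t, x)⟫ ≥ −C₀ |x − c|/ℓ(t)` on `[t₀, T'] × B(c, ℓ₀)`

(implied by `|ū| ≤ C₀/ℓ(t)` on the MERIDIONAL part alone), the swirl bound `|Γ| ≤ C_Γ`, the base
bound `|u(t₀, ·)| ≤ V₀` and the force bound `|f| ≤ F₀` on `B̄(c, ℓ₀)`:

* **`exists_swirl_le_rateBarrier`** — `|Γ(t, x)| ≤ K Ψ_a(|x − c|/ℓ(t))` on the SHRINKING balls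
  `|x − c| ≤ ℓ(t)`, `t ∈ [t₀, T']`, with `Ψ_a(s) = (1 − e^{−as})/a`, `a = (C₀ + 1)/ν` and
  `K = e^{a}(C_Γ + V₀ℓ₀ + F₀ℓ₀³)` — independent of `T'`, of `ℓ` beyond `ℓ₀`, and of the solution.

Since `Ψ_a(s) ≤ s`, at the foot of `x` on the axis (`|x − foot| = r`) this reads
`|u_θ(t, x)| ≤ K/ℓ(t)` inside `r ≤ ℓ(t)` (and `|u_θ| = |Γ|/r ≤ C_Γ/ℓ(t)` outside): THE SWIRL
VELOCITY NEVER GROWS FASTER THAN THE MERIDIONAL VELOCITY near the axis (`ClayBlowupSwirlRate.lean`).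

## The comparison

`weak_max_principle_shrinking` (Lieberman II.2.1/2.3 on `{|x − c| ≤ ℓ(t)}`) for `w = σΓ − Φ`,
`σ = ±1`, `Φ(t, x) = K Ψ_a(|x − c|/ℓ(t))`: at an interior critical point `σ∇Γ = ∇Φ`, `σΔΓ ≤ ΔΦ`,
and since `c` is on the axis `⟪x − c, e_r⟫ = r`, so the singular drift `−ν(2/r)∂ᵣ` cancels the
spherical part of `νΔΦ`; what is left is `−ℓ⁻²Ke^{−as}(νa − C₀) + ρF₀ ≤ −ℓ⁻²Ke^{−a} + ℓF₀ ≤ 0`,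
while `∂ₜΦ ≥ 0` because `ℓ` is non-increasing — no similarity structure is needed. Boundary:
`Γ = 0 ≤ Φ` on the axis, `|Γ| ≤ C_Γ ≤ Ke^{−a} ≤ KΨ_a(1)` on the moving sphere,
`|Γ(t₀)| ≤ ρV₀ ≤ Kρe^{−a}/ℓ₀` at the base.

WHAT THIS IS NOT: not a statement about blow-up — an a priori comparison lemma for classical forced
axisymmetric solutions. References: Koch–Nadirashvili–Seregin–Šverák, Acta Math. 203 (2009), §1
(1.8)–(1.9) [cite: KochNadirashviliSereginSverak2009, §1 (1.8)–(1.9) (arXiv p. 2)]; Lieberman 1996,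
Ch. II [cite: Lieberman1996, Ch. II Lemma 2.1 and Lemma 2.3]; Seregin–Šverák 2009, p. 4 («replace `v̄`
by `v`») [cite: SereginSverak2009, §1 p. 4].
-/

noncomputable section

open MeasureTheory Set Function Filter Topology Metric InnerProductSpace WithLp
open scoped RealInnerProductSpace Laplacian ContDiff NNReal
open Literature.Analysis Literature.Analysis.FluidPDE

namespace Summit.NavierStokesRegularity.FluidComputer

section Rate

/-- **THE SWIRL NEVER BLOWS UP FASTER THAN THE MERIDIONAL FLOW — the barrier on shrinking balls.**
For `ν > 0`, `C₀, C_Γ, V₀, F₀ ≥ 0`, `ℓ₀ > 0`, with `a = (C₀ + 1)/ν` and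
`K = e^{a}(C_Γ + V₀ℓ₀ + F₀ℓ₀³)`: for every `t₀ < T'`, every differentiable positive non-increasing
`ℓ ≤ ℓ₀` on `[t₀, T']`, every classical forced solution on `[t₀, T'] × ℝ³` with axisymmetric velocity
and force, every axis point `c`, under `⟪x − c, u⟫ ≥ −C₀|x − c|/ℓ(t)` on `B(c, ℓ₀)`, `|Γ| ≤ C_Γ`,
`|u(t₀)| ≤ V₀`, `|f| ≤ F₀` on `B̄(c, ℓ₀)`: `|Γ(t, x)| ≤ K Ψ_a(|x − c|/ℓ(t))` whenever `|x − c| ≤ ℓ(t)`.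
[cite: KochNadirashviliSereginSverak2009, §1 (1.8)–(1.9) (arXiv p. 2)] -/
theorem exists_swirl_le_rateBarrier {ν C₀ CΓ V₀ F₀ ℓ₀ : ℝ} (hν : 0 < ν) (hC₀ : 0 ≤ C₀)
    (hCΓ : 0 ≤ CΓ) (hV₀ : 0 ≤ V₀) (hF₀ : 0 ≤ F₀) (hℓ₀ : 0 < ℓ₀) :
    ∃ K : ℝ, 0 ≤ K ∧
      ∀ (t₀ T' : ℝ) (ℓ dℓ : ℝ → ℝ)
        (v f : ℝ → (EuclideanSpace ℝ (Fin 3)) → (EuclideanSpace ℝ (Fin 3)))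
        (q : ℝ → (EuclideanSpace ℝ (Fin 3)) → ℝ) (c : EuclideanSpace ℝ (Fin 3)), t₀ < T' →
        IsClassicalNSSolutionOn (Icc t₀ T') ν f v q →
        (∀ t ∈ Icc t₀ T', IsAxisymmetric (v t)) → (∀ t ∈ Icc t₀ T', IsAxisymmetric (f t)) →
        cylRadius c = 0 →
        (∀ t ∈ Icc t₀ T', HasDerivAt ℓ (dℓ t) t) → (∀ t ∈ Icc t₀ T', dℓ t ≤ 0) →
        (∀ t ∈ Icc t₀ T', 0 < ℓ t) → (∀ t ∈ Icc t₀ T', ℓ t ≤ ℓ₀) → AntitoneOn ℓ (Icc t₀ T') →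
        (∀ t ∈ Icc t₀ T', ∀ x ∈ ball c ℓ₀,
          -(C₀ * ‖x - c‖ / ℓ t) ≤ ⟪x - c, v t x⟫) →
        (∀ t ∈ Icc t₀ T', ∀ x ∈ closedBall c ℓ₀, |swirl (v t) x| ≤ CΓ) →
        (∀ x ∈ closedBall c ℓ₀, ‖v t₀ x‖ ≤ V₀) →
        (∀ t ∈ Icc t₀ T', ∀ x ∈ closedBall c ℓ₀, ‖f t x‖ ≤ F₀) →
        ∀ t ∈ Icc t₀ T', ∀ x : EuclideanSpace ℝ (Fin 3), ‖x - c‖ ≤ ℓ t →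
          |swirl (v t) x| ≤ K * ((1 - Real.exp (-((C₀ + 1) / ν * (‖x - c‖ / ℓ t)))) / ((C₀ + 1) / ν)) := by
  set a : ℝ := (C₀ + 1) / ν with ha
  have ha0 : 0 < a := by rw [ha]; positivity
  set K : ℝ := Real.exp a * (CΓ + V₀ * ℓ₀ + F₀ * ℓ₀ ^ 3) with hK
  have hK0 : 0 ≤ K := by rw [hK]; positivity
  have hEa : Real.exp a * Real.exp (-a) = 1 := by rw [← Real.exp_add]; simp
  have hKe : K * Real.exp (-a) = CΓ + V₀ * ℓ₀ + F₀ * ℓ₀ ^ 3 := by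
    rw [hK, mul_right_comm, hEa, one_mul]
  have hVℓ : 0 ≤ V₀ * ℓ₀ := mul_nonneg hV₀ hℓ₀.le; have hFℓ : 0 ≤ F₀ * ℓ₀ ^ 3 := by positivity
  have hKΓ : CΓ ≤ K * Real.exp (-a) := by rw [hKe]; linarith
  have hKV : V₀ * ℓ₀ ≤ K * Real.exp (-a) := by rw [hKe]; linarith
  have hKF : F₀ * ℓ₀ ^ 3 ≤ K * Real.exp (-a) := by rw [hKe]; linarith
  refine ⟨K, hK0, ?_⟩
  intro t₀ T' ℓ dℓ v f q c ht₀ hcl haxi hfaxi hc hℓd hdℓ hℓpos hℓle hanti hdrift hΓ hV₀b hF₀b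
  have ht₀I : t₀ ∈ Icc t₀ T' := ⟨le_rfl, ht₀.le⟩
  have hℓc : ContinuousOn ℓ (Icc t₀ T') := fun t ht => (hℓd t ht).continuousAt.continuousWithinAt
  -- ### reduction to the two one-sided statements
  set Φ : ℝ → (EuclideanSpace ℝ (Fin 3)) → ℝ := fun t x =>
    K * ((1 - Real.exp (-(a * ((ℓ t)⁻¹ * Real.sqrt (‖x - c‖ ^ 2))))) / a) with hΦ
  have hΦeq : ∀ t x, Φ t x = K * ((1 - Real.exp (-(a * (‖x - c‖ / ℓ t)))) / a) := by
    intro t x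
    simp only [hΦ, Real.sqrt_sq (norm_nonneg _), inv_mul_eq_div]
  suffices key : ∀ σ : ℝ, (σ = 1 ∨ σ = -1) →
      ∀ t ∈ Icc t₀ T', ∀ x ∈ closedBall c (ℓ t), σ * swirl (v t) x - Φ t x ≤ 0 by
    intro t ht x hx
    rw [← hΦeq t x]
    have hx' : x ∈ closedBall c (ℓ t) := mem_closedBall_iff_norm.2 hx
    have h1 := key 1 (Or.inl rfl) t ht x hx'; have h2 := key (-1) (Or.inr rfl) t ht x hx'
    rw [one_mul] at h1; rw [neg_one_mul] at h2
    exact abs_le.2 ⟨by linarith, by linarith⟩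
  intro σ hσ
  have hσabs : ∀ b : ℝ, σ * b ≤ |b| := fun b => by
    rcases hσ with h | h <;> rw [h] <;> simp [le_abs_self, neg_le_abs]
  -- ### Φ ≥ 0, and Φ ≥ K e^{-a} |x - c| / ℓ t on the ball `|x - c| ≤ ℓ t`
  have hΦlow : ∀ t ∈ Icc t₀ T', ∀ x ∈ closedBall c (ℓ t),
      K * Real.exp (-a) * (‖x - c‖ / ℓ t) ≤ Φ t x ∧ 0 ≤ Φ t x := by
    intro t ht x hx
    rw [hΦeq t x]
    exact swirlProfile_scale_lower hK0 ha0 (hℓpos t ht) (norm_nonneg _)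
      (mem_closedBall_iff_norm.1 hx)
  -- ### the pressure is axisymmetric: the swirl equation holds off the axis
  have hp : ∀ t ∈ Icc t₀ T', IsAxisymmetricScalar (q t) := fun t ht =>
    hcl.isAxisymmetricScalar_pressure (uniqueDiffOn_Icc ht₀) haxi hfaxi ht
  -- ### the comparison function on the shrinking balls
  set w : ℝ → (EuclideanSpace ℝ (Fin 3)) → ℝ := fun t x => σ * swirl (v t) x - Φ t x with hw
  set Γₜ : ℝ → (EuclideanSpace ℝ (Fin 3)) → ℝ := fun t x =>
    timeDerivWithin (Icc t₀ T') (fun s => swirl (v s)) t x with hΓₜ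
  set Φₜ : ℝ → (EuclideanSpace ℝ (Fin 3)) → ℝ := fun t x =>
    K * (Real.exp (-(a * ((ℓ t)⁻¹ * ‖x - c‖))) * (-(dℓ t) / ℓ t ^ 2 * ‖x - c‖)) with hΦₜ
  set wₜ : ℝ → (EuclideanSpace ℝ (Fin 3)) → ℝ := fun t x => σ * Γₜ t x - Φₜ t x with hwₜ
  set Kt : ℝ → Set (EuclideanSpace ℝ (Fin 3)) := fun t => closedBall c (ℓ t) with hKt
  set U : ℝ → Set (EuclideanSpace ℝ (Fin 3)) := fun t =>
    ball c (ℓ t) ∩ {x | cylRadius x ≠ 0} with hU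
  have hK₀ : IsCompact (closedBall c ℓ₀) := isCompact_closedBall _ _
  have hKsub : ∀ t ∈ Icc t₀ T', Kt t ⊆ closedBall c ℓ₀ := fun t ht =>
    closedBall_subset_closedBall (hℓle t ht)
  have hgraph : IsClosed {p : ℝ × (EuclideanSpace ℝ (Fin 3)) | p.1 ∈ Icc t₀ T' ∧ p.2 ∈ Kt p.1} :=
    isClosed_graph_closedBall hℓc c
  have hantiK : ∀ s t, t₀ ≤ s → s ≤ t → t ≤ T' → Kt t ⊆ Kt s := fun s t hs hst htT =>
    closedBall_subset_closedBall (hanti ⟨hs, hst.trans htT⟩ ⟨hs.trans hst, htT⟩ hst)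
  have hUo : ∀ t, IsOpen (U t) := fun t =>
    isOpen_ball.inter (isOpen_ne_fun continuous_cylRadius continuous_const)
  have hUK : ∀ t, U t ⊆ Kt t := fun t x hx => ball_subset_closedBall hx.1
  have hUc : ∀ t, ∀ x ∈ U t, x ≠ c := fun t x hx h => hx.2 (by rw [h]; exact hc)
  -- regularity of the velocity
  have hsm := hcl.smooth_velocity
  have hvC2 : ∀ t ∈ Icc t₀ T', ContDiff ℝ 2 (v t) := fun t ht =>
    (hcl.contDiff_velocity ht).of_le (by norm_cast)
  have hvd : ∀ t ∈ Icc t₀ T', ∀ x, DifferentiableAt ℝ (v t) x := fun t ht x =>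
    ((hvC2 t ht).of_le one_le_two).differentiable one_ne_zero x
  -- (a) joint continuity on `[t₀, T'] × ℝ³`
  have hcont : ContinuousOn (uncurry w)
      {p : ℝ × (EuclideanSpace ℝ (Fin 3)) | p.1 ∈ Icc t₀ T' ∧ p.2 ∈ Kt p.1} := by
    have hsub : {p : ℝ × (EuclideanSpace ℝ (Fin 3)) | p.1 ∈ Icc t₀ T' ∧ p.2 ∈ Kt p.1} ⊆
        Icc t₀ T' ×ˢ univ := fun p hp => mk_mem_prod hp.1 (mem_univ _)
    refine ContinuousOn.mono ?_ hsub
    have hvc : ContinuousOn (uncurry v) (Icc t₀ T' ×ˢ univ) := hsm.continuousOn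
    have h1 : ContinuousOn (fun p : ℝ × (EuclideanSpace ℝ (Fin 3)) => ⟪rotGenL p.2, uncurry v p⟫)
        (Icc t₀ T' ×ˢ univ) :=
      (rotGenL.continuous.comp continuous_snd).continuousOn.inner hvc
    have h2 : ContinuousOn (fun p : ℝ × (EuclideanSpace ℝ (Fin 3)) => Φ p.1 p.2)
        (Icc t₀ T' ×ˢ univ) :=
      continuousOn_swirlProfile_scale K a c hℓc fun t ht => (hℓpos t ht).ne'
    refine (((continuousOn_const (c := σ)).mul h1).sub h2).congr fun p _ => ?_
    simp only [hw, uncurry, rotGenL_apply, swirl_eq_inner_rotGen, Pi.sub_apply, Pi.mul_apply]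
  -- (b) `C²` slices at the points of `U t`
  have h2 : ∀ t ∈ Ioc t₀ T', ∀ x ∈ U t, ContDiffAt ℝ 2 (w t) x := by
    intro t ht x hx
    have htI : t ∈ Icc t₀ T' := ⟨ht.1.le, ht.2⟩
    have hΦc : ContDiffAt ℝ 2 (Φ t) x :=
      contDiffAt_swirlProfile_comp (K := K) (a := a) (μ := (ℓ t)⁻¹) (hUc t x hx)
    exact ((contDiff_const.mul (contDiff_swirl (hvC2 t htI))).contDiffAt).sub hΦc
  -- (c) the left time derivative
  have htime : ∀ t ∈ Ioc t₀ T', ∀ x ∈ U t,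
      HasDerivWithinAt (fun s => w s x) (wₜ t x) (Icc t₀ t) t := by
    intro t ht x _
    have htI : t ∈ Icc t₀ T' := ⟨ht.1.le, ht.2⟩
    have hΓ' : HasDerivWithinAt (fun s => swirl (v s) x) (Γₜ t x) (Icc t₀ T') t := by
      have hd : DifferentiableWithinAt ℝ (fun s => swirl (v s) x) (Icc t₀ T') t := by
        have h1 := hsm.differentiableWithinAt_time htI x
        simp only [swirl_eq_inner_rotGen]
        exact (differentiableWithinAt_const _).inner ℝ h1
      have := hd.hasDerivWithinAt
      simp only [hΓₜ, timeDerivWithin_apply]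
      exact this
    have hΦ' : HasDerivAt (fun s => Φ s x) (Φₜ t x) t := by
      have h := hasDerivAt_swirlProfile_scale (K := K) (ρ := ‖x - c‖) ha0.ne' (hℓd t htI)
        (hℓpos t htI).ne'
      simp only [hΦ, hΦₜ, Real.sqrt_sq (norm_nonneg _)]
      exact h
    have h := ((hΓ'.const_mul σ).sub hΦ'.hasDerivWithinAt).mono (Icc_subset_Icc_right ht.2)
    simp only [hw, hwₜ]
    exact h
  -- (d) the interior inequality at a critical point
  have hsub : ∀ t ∈ Ioc t₀ T', ∀ x ∈ U t,
      fderiv ℝ (w t) x = 0 → (Δ (w t)) x ≤ 0 → wₜ t x ≤ 0 := by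
    intro t ht x hx hgrad hlap
    have htI : t ∈ Icc t₀ T' := ⟨ht.1.le, ht.2⟩
    have hr : cylRadius x ≠ 0 := hx.2
    have hxc : x ≠ c := hUc t x hx
    have hρ0 : 0 < ‖x - c‖ := norm_pos_iff.2 (sub_ne_zero.2 hxc)
    set ρ : ℝ := ‖x - c‖ with hρ
    have hρℓ : ρ ≤ ℓ t := by
      have := hx.1; rw [mem_ball_iff_norm] at this; exact this.le
    have hℓt : 0 < ℓ t := hℓpos t htI
    set μ : ℝ := (ℓ t)⁻¹ with hμdef
    have hμ0 : 0 < μ := inv_pos.2 hℓt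
    set e : ℝ := Real.exp (-(a * (μ * ρ))) with he
    have he0 : 0 < e := Real.exp_pos _
    have hsqρ : Real.sqrt (ρ ^ 2) = ρ := Real.sqrt_sq hρ0.le
    have hσpos : 0 < ρ ^ 2 := by positivity
    -- the two derivative values of Φ (the `A = 0` profile at scale `μ = 1/ℓ t`)
    set g₁ : ℝ := K * (Real.exp (-(a * (μ * Real.sqrt (ρ ^ 2)))) * (μ / (2 * Real.sqrt (ρ ^ 2))))
      with hg₁
    have hg₁v : g₁ = K * μ * e / ρ / 2 := by
      have h := two_mul_swirlProfileSq₁ K a μ hρ0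
      rw [hg₁, he]; linarith
    have hg₁0 : 0 ≤ g₁ := by rw [hg₁v]; positivity
    have hlapv : 4 * (-(K * μ / 4) * Real.exp (-(a * (μ * Real.sqrt (ρ ^ 2)))) *
          (a * μ / ρ ^ 2 + 1 / (ρ ^ 2 * Real.sqrt (ρ ^ 2)))) * ρ ^ 2 + 6 * g₁ =
        -(K * a * μ ^ 2 * e) + 2 * K * μ * e / ρ := by
      rw [hg₁, he]; exact laplacian_value_swirlProfileSq K a μ hρ0
    -- the swirl equation at `(t, x)`, with the force
    have hpde := swirl_transport_holds hcl haxi hp htI hr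
    rw [convect_apply, partialDeriv_apply] at hpde
    -- gradient condition
    have hΓd : DifferentiableAt ℝ (swirl (v t)) x := differentiableAt_swirl (hvd t htI x)
    have hΦd : HasFDerivAt (Φ t) ((2 * g₁) • (innerSL ℝ (x - c) :
        (EuclideanSpace ℝ (Fin 3)) →L[ℝ] ℝ)) x := by
      have h := hasFDerivAt_comp_norm_sub_sq (c := c) (x := x)
        (hasDerivAt_swirlProfileSq K μ ha0.ne' hσpos)
      simp only [hΦ, hg₁, hρ, hμdef] at h ⊢
      exact h
    have hwderiv : HasFDerivAt (w t) (σ • fderiv ℝ (swirl (v t)) x -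
        (2 * g₁) • (innerSL ℝ (x - c) : (EuclideanSpace ℝ (Fin 3)) →L[ℝ] ℝ)) x := by
      have h := (hΓd.hasFDerivAt.const_mul σ).sub hΦd
      simp only [hw]
      exact h
    have hDeq : σ • fderiv ℝ (swirl (v t)) x =
        (2 * g₁) • (innerSL ℝ (x - c) : (EuclideanSpace ℝ (Fin 3)) →L[ℝ] ℝ) := by
      have := hwderiv.fderiv
      rw [hgrad] at this
      exact (sub_eq_zero.1 this.symm)
    have hDapply : ∀ h : EuclideanSpace ℝ (Fin 3),
        σ * fderiv ℝ (swirl (v t)) x h = 2 * g₁ * ⟪x - c, h⟫ := fun h => by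
      have := congrArg (fun L : (EuclideanSpace ℝ (Fin 3)) →L[ℝ] ℝ => L h) hDeq
      simpa only [smul_apply, innerSL_apply_apply, smul_eq_mul] using this
    -- Laplacian condition
    have hΦlap : (Δ (Φ t)) x =
        4 * (-(K * μ / 4) * Real.exp (-(a * (μ * Real.sqrt (ρ ^ 2)))) *
          (a * μ / ρ ^ 2 + 1 / (ρ ^ 2 * Real.sqrt (ρ ^ 2)))) * ρ ^ 2 + 6 * g₁ := by
      have h := laplacian_comp_norm_sub_sq (c := c) (x := x) isOpen_Ioi
        (fun σ hσ => hasDerivAt_swirlProfileSq K μ ha0.ne' hσ) hσpos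
        (hasDerivAt_swirlProfileSq₁ K a μ hσpos)
      simp only [hΦ, hg₁, hρ, hμdef] at h ⊢
      exact h
    have hΔeq : (Δ (w t)) x = σ * (Δ (swirl (v t))) x - (Δ (Φ t)) x := by
      have h1 : ContDiffAt ℝ 2 (fun y => σ * swirl (v t) y) x :=
        (contDiff_const.mul (contDiff_swirl (hvC2 t htI))).contDiffAt
      have h2' : ContDiffAt ℝ 2 (Φ t) x :=
        contDiffAt_swirlProfile_comp (K := K) (a := a) (μ := μ) hxc
      have h3 : (Δ (fun y => σ * swirl (v t) y)) x = σ * (Δ (swirl (v t))) x := by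
        have : (fun y => σ * swirl (v t) y) = σ • swirl (v t) := by
          funext y; simp [smul_eq_mul]
        rw [this, laplacian_smul σ ((contDiff_swirl (hvC2 t htI)).contDiffAt), smul_eq_mul]
      have h4 := h1.laplacian_sub h2'
      have hfun : w t = (fun y => σ * swirl (v t) y) - Φ t := by
        funext y; simp only [hw, Pi.sub_apply]
      rw [hfun, h4, h3]
    have hΔ : σ * (Δ (swirl (v t))) x ≤
        4 * (-(K * μ / 4) * Real.exp (-(a * (μ * Real.sqrt (ρ ^ 2)))) *
          (a * μ / ρ ^ 2 + 1 / (ρ ^ 2 * Real.sqrt (ρ ^ 2)))) * ρ ^ 2 + 6 * g₁ := by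
      rw [hΔeq, hΦlap] at hlap; linarith
    -- the singular drift term: `⟪x − c, e_r⟫ = r`
    have hrad : σ * fderiv ℝ (swirl (v t)) x (eR x) = 2 * g₁ * cylRadius x := by
      rw [hDapply, inner_sub_axisPoint_eR hc]
    -- the one-sided drift term
    have hconv : -(σ * fderiv ℝ (swirl (v t)) x (v t x)) ≤ 2 * g₁ * (C₀ * ρ * μ) := by
      rw [hDapply]
      have h1 := hdrift t htI x (ball_subset_ball (hℓle t htI) hx.1)
      have h2 : C₀ * ‖x - c‖ / ℓ t = C₀ * ρ * μ := by rw [hρ, hμdef, div_eq_mul_inv]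
      rw [h2] at h1
      have h3 : -⟪x - c, v t x⟫ ≤ C₀ * ρ * μ := by linarith
      calc -(2 * g₁ * ⟪x - c, v t x⟫) = 2 * g₁ * (-⟪x - c, v t x⟫) := by ring
        _ ≤ 2 * g₁ * (C₀ * ρ * μ) := mul_le_mul_of_nonneg_left h3 (by positivity)
    -- the force term
    have hforce : σ * swirl (f t) x ≤ ρ * F₀ := by
      refine (hσabs _).trans ?_
      have hxB : x ∈ closedBall c ℓ₀ :=
        closedBall_subset_closedBall (hℓle t htI) (ball_subset_closedBall hx.1)
      calc |swirl (f t) x| ≤ cylRadius x * ‖f t x‖ := abs_swirl_le_cylRadius_mul_norm (f t) x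
        _ ≤ ρ * F₀ := mul_le_mul (cylRadius_le_norm_sub_axisPoint hc x) (hF₀b t htI x hxB)
            (norm_nonneg _) hρ0.le
    -- assemble `σ Γₜ`
    have hΓeq : Γₜ t x = ν * ((Δ (swirl (v t))) x -
        2 / cylRadius x * fderiv ℝ (swirl (v t)) x (eR x)) -
        fderiv ℝ (swirl (v t)) x (v t x) + swirl (f t) x := by
      have := eq_sub_of_add_eq hpde
      simp only [hΓₜ]
      rw [this]
      ring
    have hΓt : σ * Γₜ t x ≤ -(K * μ ^ 2 * e) + ρ * F₀ := by
      have e1 : σ * Γₜ t x = ν * (σ * (Δ (swirl (v t))) x) -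
          ν * (2 / cylRadius x) * (σ * fderiv ℝ (swirl (v t)) x (eR x)) -
          σ * fderiv ℝ (swirl (v t)) x (v t x) + σ * swirl (f t) x := by
        rw [hΓeq]; ring
      rw [e1, hrad]
      have e2 : ν * (2 / cylRadius x) * (2 * g₁ * cylRadius x) = 4 * ν * g₁ := by
        field_simp
        ring
      rw [e2]
      have h1 := mul_le_mul_of_nonneg_left hΔ hν.le
      rw [hlapv] at h1
      -- `ν(-K a μ² e + 2Kμe/ρ) - 4ν g₁ + 2 g₁ C₀ ρ μ = K μ² e (C₀ - ν a) = -K μ² e`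
      have hid : ν * (-(K * a * μ ^ 2 * e) + 2 * K * μ * e / ρ) - 4 * ν * g₁ +
          2 * g₁ * (C₀ * ρ * μ) = -(K * μ ^ 2 * e) := by
        rw [hg₁v, ha]
        field_simp
        ring
      linarith
    -- the time derivative of Φ is nonnegative (ℓ is non-increasing)
    have hΦₜ0 : 0 ≤ Φₜ t x := by
      simp only [hΦₜ]
      have h1 : 0 ≤ -(dℓ t) / ℓ t ^ 2 * ‖x - c‖ := by
        have := hdℓ t htI
        have : 0 ≤ -(dℓ t) := by linarith
        positivity
      have h2 : 0 ≤ Real.exp (-(a * ((ℓ t)⁻¹ * ‖x - c‖))) := (Real.exp_pos _).le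
      exact mul_nonneg hK0 (mul_nonneg h2 h1)
    -- the supersolution inequality: `K μ² e ≥ K e^{-a}/ℓ² ≥ ℓ F₀ ≥ ρ F₀`
    have hs1 : μ * ρ ≤ 1 := by
      rw [hμdef, inv_mul_le_iff₀ hℓt]; simpa using hρℓ
    have hea : Real.exp (-a) ≤ e := by
      rw [he]; apply Real.exp_le_exp.2
      have := mul_le_mul_of_nonneg_left hs1 ha0.le
      linarith
    have hmain : ρ * F₀ ≤ K * μ ^ 2 * e := by
      have hℓ3 : ℓ t ^ 3 ≤ ℓ₀ ^ 3 := pow_le_pow_left₀ hℓt.le (hℓle t htI) 3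
      have h1 : ρ * F₀ ≤ ℓ t * F₀ := mul_le_mul_of_nonneg_right hρℓ hF₀
      have h2 : ℓ t * F₀ * ℓ t ^ 2 ≤ F₀ * ℓ₀ ^ 3 := by
        calc ℓ t * F₀ * ℓ t ^ 2 = F₀ * ℓ t ^ 3 := by ring
          _ ≤ F₀ * ℓ₀ ^ 3 := mul_le_mul_of_nonneg_left hℓ3 hF₀
      have h3 : F₀ * ℓ₀ ^ 3 ≤ K * e := hKF.trans (mul_le_mul_of_nonneg_left hea hK0)
      have h4 : ℓ t * F₀ ≤ K * μ ^ 2 * e := by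
        rw [hμdef, inv_pow, show K * (ℓ t ^ 2)⁻¹ * e = K * e / ℓ t ^ 2 by ring,
          le_div_iff₀ (by positivity)]
        linarith
      exact h1.trans h4
    have e3 : wₜ t x = σ * Γₜ t x - Φₜ t x := by simp only [hwₜ]
    rw [e3]
    linarith
  -- (e) the parabolic boundary: `t = t₀`
  have hbot : ∀ x ∈ Kt t₀, w t₀ x ≤ 0 := by
    intro x hx
    obtain ⟨hlow, -⟩ := hΦlow t₀ ht₀I x hx
    have hxB : x ∈ closedBall c ℓ₀ := hKsub t₀ ht₀I hx
    have h1 : σ * swirl (v t₀) x ≤ ‖x - c‖ * V₀ := by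
      refine (hσabs _).trans ?_
      calc |swirl (v t₀) x| ≤ cylRadius x * ‖v t₀ x‖ := abs_swirl_le_cylRadius_mul_norm (v t₀) x
        _ ≤ ‖x - c‖ * V₀ := mul_le_mul (cylRadius_le_norm_sub_axisPoint hc x) (hV₀b x hxB)
            (norm_nonneg _) (norm_nonneg _)
    -- `‖x - c‖ V₀ ≤ K e^{-a} ‖x - c‖/ℓ₀ ≤ K e^{-a} ‖x - c‖ / ℓ t₀`
    have hℓt₀ := hℓpos t₀ ht₀I
    have h2 : ‖x - c‖ * V₀ ≤ K * Real.exp (-a) * (‖x - c‖ / ℓ t₀) := by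
      have h3 : ‖x - c‖ * V₀ * ℓ t₀ ≤ K * Real.exp (-a) * ‖x - c‖ := by
        have h5 : V₀ * ℓ t₀ ≤ K * Real.exp (-a) :=
          (mul_le_mul_of_nonneg_left (hℓle t₀ ht₀I) hV₀).trans hKV
        calc ‖x - c‖ * V₀ * ℓ t₀ = ‖x - c‖ * (V₀ * ℓ t₀) := by ring
          _ ≤ ‖x - c‖ * (K * Real.exp (-a)) := mul_le_mul_of_nonneg_left h5 (norm_nonneg _)
          _ = K * Real.exp (-a) * ‖x - c‖ := by ring
      rw [show K * Real.exp (-a) * (‖x - c‖ / ℓ t₀) = K * Real.exp (-a) * ‖x - c‖ / ℓ t₀ by ring,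
        le_div_iff₀ hℓt₀]
      exact h3
    simp only [hw]
    linarith
  -- (f) the parabolic boundary: the axis and the moving sphere `|x - c| = ℓ t`
  have hlat : ∀ t ∈ Icc t₀ T', ∀ x ∈ Kt t \ U t, w t x ≤ 0 := by
    intro t ht x hx
    obtain ⟨hlow, hΦ0⟩ := hΦlow t ht x hx.1
    simp only [hw]
    by_cases hax : cylRadius x = 0
    · rw [swirl_eq_zero_of_cylRadius_eq_zero (v t) hax, mul_zero]
      linarith
    · have hℓt := hℓpos t ht
      have hxρ : ‖x - c‖ = ℓ t := by
        have hnot : x ∉ ball c (ℓ t) := fun hb => hx.2 ⟨hb, hax⟩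
        rw [mem_ball_iff_norm, not_lt] at hnot
        exact le_antisymm (mem_closedBall_iff_norm.1 hx.1) hnot
      have h1 : σ * swirl (v t) x ≤ CΓ := (hσabs _).trans (hΓ t ht x (hKsub t ht hx.1))
      rw [hxρ, div_self hℓt.ne', mul_one] at hlow
      linarith
  intro t ht x hx
  exact weak_max_principle_shrinking hK₀ hKsub hgraph hantiK hUo hUK hcont h2 htime hsub hbot hlat
    t ht x hx

end Rate

end Summit.NavierStokesRegularity.FluidComputer

end
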